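import Mathlib
import Literature.Analysis.FluidPDE.LocalTypeIBlowup.Compactness
import Literature.Analysis.FluidPDE.SlabTypeICompactness
import Summits.NavierStokesRegularity.NavierStokesRegularity.Theorems.EulerZoomLiouvilleSereginZoomReductionCylinderCompactness
import HarnessLib

/-!
# Compactness of suitable weak Navier–Stokes solutions with VANISHING viscosities on growing parabolic
# cylinders: one limit on the backward slab (support item `EulerZoomLiouville.SereginZoomReduction` = stmt-19834)

Route `EulerZoomLiouville` (NavierStokesRegularity), support item Z = Seregin's Euler-zoom theorem (Seregin 2026
Thm 3.1 = Seregin 2023 Prop 1.2 at `(s,l,κ) = (3,3,2)`, `f(r) = r^ρ`).  The Euler-zoomed sequence `v_k` is a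
suitable weak solution (viscosity `ν_k → 0`) on `Q(0, 2ᵐ)` for `m ≤ k`, with level-wise uniform bounds.  This
file glues the one-cylinder limits of `cylinder_compactness_vanishingViscosity` along ONE diagonal subsequence
into ONE pair `(u, p)` on the slab `(−∞,0) × ℝ³` (the bookkeeping of the tree's tail-tolerant
`LocalTypeIBlowup.local_suitableCompactness`, without zooms: Cantor diagonal
`FunctionSpaces.exists_strictMono_forall_of_extraction`, a.e. uniqueness of strong `L³` / weak `L^{3/2}`
limits, `FunctionSpaces.exists_glue_of_ae_eq`, and `IsSuitableWeakSolutionOn.of_exhaustion`):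

* `slab_compactness_vanishingViscosity` — one `σ` and one `(u, p)`, a suitable weak EULER solution on the
  slab, such that on every `Q(0, 2ᵐ)`: `v_{σ j} → u` in `L³`, `q_{σ j} ⇀ p` weakly in `L^{3/2}`, and `(u, p)`
  keeps the level bounds (slice energy, some weak gradient, pressure).

WHAT THIS IS NOT: not NS regularity, not the crux; a helper `--supports` stmt-19834. [folklore]
-/

noncomputable section

set_option linter.dupNamespace false

open MeasureTheory TopologicalSpace Set Function Filter Topology Metric Bornology
open scoped NNReal ENNReal InnerProductSpace RealInnerProductSpace

namespace Summit.NavierStokesRegularity.NavierStokesRegularity.Theorems.SereginZoomReduction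

open Literature.Analysis Literature.Analysis.FluidPDE Literature.Analysis.FunctionSpaces

/-- **One subsequence and one Euler limit on the slab, from level-wise vanishing-viscosity compactness.**
Let `(V_k, P_k)` be suitable weak solutions of Navier–Stokes with viscosities `ν_k ∈ [0,1]`, `ν_k → 0`, on
`Q(0, 2ᵐ)` whenever `m ≤ k`, with weak gradients `G_k` there and the level bounds
`∫_{B(0,2ᵐ)} |V_k(t)|² ≤ C_m` (a.e. `t`), `∫_{Q(0,2ᵐ)} |G_k|² ≤ C_m`, `∫_{Q(0,2ᵐ)} |P_k|^{3/2} ≤ M_m` (`m ≤ k`).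
Then there are a strictly increasing `σ` and a pair `(u, p)` which is a suitable weak EULER solution on the
slab `(−∞, 0) × ℝ³` and, for every level `m`: a suitable weak Euler solution on `Q(0,2ᵐ)` with
`u ∈ L³(Q(0,2ᵐ))`, `∫_{B(0,2ᵐ)} |u(t)|² ≤ C_m` for a.e. `t`, a weak gradient on `Q(0,2ᵐ)` of square mass
`≤ C_m`, `∫_{Q(0,2ᵐ)} |p|^{3/2} ≤ M_m`, `V_{σ j} → u` in `L³(Q(0,2ᵐ))` and `P_{σ j} ⇀ p` weakly in
`L^{3/2}(Q(0,2ᵐ))`. [folklore] -/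
theorem slab_compactness_vanishingViscosity
    {ν : ℕ → ℝ} (hν0 : ∀ k, 0 ≤ ν k) (hν1 : ∀ k, ν k ≤ 1) (hνlim : Tendsto ν atTop (𝓝 0))
    {V : ℕ → ℝ → (EuclideanSpace ℝ (Fin 3)) → (EuclideanSpace ℝ (Fin 3))}
    {P : ℕ → ℝ → (EuclideanSpace ℝ (Fin 3)) → ℝ}
    {GV : ℕ → ℝ → (EuclideanSpace ℝ (Fin 3)) → (EuclideanSpace ℝ (Fin 3)) →L[ℝ] (EuclideanSpace ℝ (Fin 3))}
    {C : ℕ → ℝ≥0} {Mp : ℕ → ℝ≥0∞} (hMp : ∀ m, Mp m ≠ ∞)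
    (hsw : ∀ m k : ℕ, m ≤ k → IsSuitableWeakSolutionOn
      (parabolicCylinderOpens ((2 : ℝ) ^ m) (0 : ℝ × (EuclideanSpace ℝ (Fin 3)))) (ν k) 0 (V k) (P k))
    (hG : ∀ m k : ℕ, m ≤ k → HasWeakSpatialGradientOn
      (parabolicCylinderOpens ((2 : ℝ) ^ m) (0 : ℝ × (EuclideanSpace ℝ (Fin 3)))) (V k) (GV k))
    (hE : ∀ m k : ℕ, m ≤ k → ∀ᵐ t ∂(volume.restrict (Ioo (-((2 : ℝ) ^ m) ^ 2) 0)),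
      ∫⁻ x in ball (0 : (EuclideanSpace ℝ (Fin 3))) ((2 : ℝ) ^ m), ‖V k t x‖ₑ ^ 2 ≤ C m)
    (hGb : ∀ m k : ℕ, m ≤ k → ∫⁻ z in parabolicCylinder ((2 : ℝ) ^ m) (0 : ℝ × (EuclideanSpace ℝ (Fin 3))),
      ENNReal.ofReal (frobeniusNormSq (GV k z.1 z.2)) ≤ C m)
    (hPb : ∀ m k : ℕ, m ≤ k → ∫⁻ z in parabolicCylinder ((2 : ℝ) ^ m) (0 : ℝ × (EuclideanSpace ℝ (Fin 3))),
      ‖P k z.1 z.2‖ₑ ^ (3 / 2 : ℝ) ≤ Mp m) :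
    ∃ (σ : ℕ → ℕ) (u : ℝ → (EuclideanSpace ℝ (Fin 3)) → (EuclideanSpace ℝ (Fin 3)))
      (p : ℝ → (EuclideanSpace ℝ (Fin 3)) → ℝ), StrictMono σ ∧
      IsSuitableWeakSolutionOn (slab (EuclideanSpace ℝ (Fin 3)) (Iio 0) isOpen_Iio) 0 0 u p ∧
      ∀ m : ℕ,
        IsSuitableWeakSolutionOn
          (parabolicCylinderOpens ((2 : ℝ) ^ m) (0 : ℝ × (EuclideanSpace ℝ (Fin 3)))) 0 0 u p ∧
        MemLp (uncurry u) 3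
          (volume.restrict (parabolicCylinder ((2 : ℝ) ^ m) (0 : ℝ × (EuclideanSpace ℝ (Fin 3))))) ∧
        (∀ᵐ t ∂(volume.restrict (Ioo (-((2 : ℝ) ^ m) ^ 2) 0)),
          ∫⁻ x in ball (0 : (EuclideanSpace ℝ (Fin 3))) ((2 : ℝ) ^ m), ‖u t x‖ₑ ^ 2 ≤ C m) ∧
        (∃ Gu : ℝ → (EuclideanSpace ℝ (Fin 3)) → (EuclideanSpace ℝ (Fin 3)) →L[ℝ] (EuclideanSpace ℝ (Fin 3)),
          HasWeakSpatialGradientOn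
            (parabolicCylinderOpens ((2 : ℝ) ^ m) (0 : ℝ × (EuclideanSpace ℝ (Fin 3)))) u Gu ∧
          ∫⁻ z in parabolicCylinder ((2 : ℝ) ^ m) (0 : ℝ × (EuclideanSpace ℝ (Fin 3))),
            ENNReal.ofReal (frobeniusNormSq (Gu z.1 z.2)) ≤ C m) ∧
        AEStronglyMeasurable (uncurry p)
          (volume.restrict (parabolicCylinder ((2 : ℝ) ^ m) (0 : ℝ × (EuclideanSpace ℝ (Fin 3))))) ∧
        ∫⁻ z in parabolicCylinder ((2 : ℝ) ^ m) (0 : ℝ × (EuclideanSpace ℝ (Fin 3))),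
          ‖p z.1 z.2‖ₑ ^ (3 / 2 : ℝ) ≤ Mp m ∧
        Tendsto (fun j => eLpNorm (uncurry (V (σ j)) - uncurry u) 3
          (volume.restrict (parabolicCylinder ((2 : ℝ) ^ m) (0 : ℝ × (EuclideanSpace ℝ (Fin 3))))))
          atTop (𝓝 0) ∧
        ∀ g : ℝ × (EuclideanSpace ℝ (Fin 3)) → ℝ,
          MemLp g 3 (volume.restrict (parabolicCylinder ((2 : ℝ) ^ m) (0 : ℝ × (EuclideanSpace ℝ (Fin 3))))) →
          Tendsto (fun j => ∫ z in parabolicCylinder ((2 : ℝ) ^ m) (0 : ℝ × (EuclideanSpace ℝ (Fin 3))),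
              P (σ j) z.1 z.2 * g z) atTop
            (𝓝 (∫ z in parabolicCylinder ((2 : ℝ) ^ m) (0 : ℝ × (EuclideanSpace ℝ (Fin 3))), p z.1 z.2 * g z)) := by
  classical
  -- ## abbreviations
  set cc : ℕ → ℝ := fun m => (2 : ℝ) ^ m with hcc
  have hcc_pos : ∀ m, 0 < cc m := fun m => by positivity
  have hcc_mono : ∀ {n m : ℕ}, n ≤ m → cc n ≤ cc m := fun {n m} h => pow_le_pow_right₀ (by norm_num) h
  set Qs : ℕ → Set (ℝ × (EuclideanSpace ℝ (Fin 3))) :=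
    fun m => parabolicCylinder (cc m) (0 : ℝ × (EuclideanSpace ℝ (Fin 3))) with hQs
  set μ : ℕ → Measure (ℝ × (EuclideanSpace ℝ (Fin 3))) := fun m => volume.restrict (Qs m) with hμ
  have hQs_mono : ∀ {n m : ℕ}, n ≤ m → Qs n ⊆ Qs m := fun {n m} h =>
    SuitableCompactness.parabolicCylinder_zero_mono (hcc_pos n).le (hcc_mono h)
  have hQsm : ∀ m, MeasurableSet (Qs m) := fun m => (isOpen_parabolicCylinder _ _).measurableSet
  set Good : ℕ → (ℕ → ℕ) →
      ((ℝ → (EuclideanSpace ℝ (Fin 3)) → (EuclideanSpace ℝ (Fin 3))) ×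
        (ℝ → (EuclideanSpace ℝ (Fin 3)) → ℝ)) → Prop :=
    fun m φ d =>
      IsSuitableWeakSolutionOn (parabolicCylinderOpens (cc m) (0 : ℝ × (EuclideanSpace ℝ (Fin 3)))) 0 0 d.1 d.2 ∧
      AEStronglyMeasurable (uncurry d.1) (μ m) ∧ MemLp (uncurry d.1) 3 (μ m) ∧
      (∀ᵐ t ∂(volume.restrict (Ioo (-(cc m) ^ 2) 0)),
        ∫⁻ x in ball (0 : (EuclideanSpace ℝ (Fin 3))) (cc m), ‖d.1 t x‖ₑ ^ 2 ≤ C m) ∧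
      (∃ Gu : ℝ → (EuclideanSpace ℝ (Fin 3)) → (EuclideanSpace ℝ (Fin 3)) →L[ℝ] (EuclideanSpace ℝ (Fin 3)),
        HasWeakSpatialGradientOn (parabolicCylinderOpens (cc m) (0 : ℝ × (EuclideanSpace ℝ (Fin 3)))) d.1 Gu ∧
        ∫⁻ z in Qs m, ENNReal.ofReal (frobeniusNormSq (Gu z.1 z.2)) ≤ C m) ∧
      AEStronglyMeasurable (uncurry d.2) (μ m) ∧
      ∫⁻ z in Qs m, ‖d.2 z.1 z.2‖ₑ ^ (3 / 2 : ℝ) ≤ Mp m ∧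
      Tendsto (fun j => eLpNorm (uncurry (V (φ j)) - uncurry d.1) 3 (μ m)) atTop (𝓝 0) ∧
      ∀ g : ℝ × (EuclideanSpace ℝ (Fin 3)) → ℝ, MemLp g 3 (μ m) →
        Tendsto (fun j => ∫ z in Qs m, P (φ j) z.1 z.2 * g z) atTop (𝓝 (∫ z in Qs m, d.2 z.1 z.2 * g z))
    with hGood
  -- ## goodness is stable under eventual subsequences
  have hsub : ∀ m (φ φ' : ℕ → ℕ), (∃ τ : ℕ → ℕ, StrictMono τ ∧ ∀ᶠ k in atTop, φ' k = φ (τ k)) →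
      (∃ d, Good m φ d) → ∃ d, Good m φ' d := by
    rintro m φ φ' ⟨τ, hτ, heq⟩ ⟨d, h1, h2, h3, h4, h5, h6, h7, h8, h9⟩
    refine ⟨d, h1, h2, h3, h4, h5, h6, h7, FunctionSpaces.tendsto_of_eventually_eq_comp
        (a := fun k => eLpNorm (uncurry (V k) - uncurry d.1) 3 (μ m)) hτ heq h8,
      fun g hg => FunctionSpaces.tendsto_of_eventually_eq_comp
        (a := fun k => ∫ z in Qs m, P k z.1 z.2 * g z) hτ heq (h9 g hg)⟩
  -- ## extraction at one level (the one-cylinder compactness on the tail `k ↦ φ (k + m)`)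
  have hex : ∀ m (φ : ℕ → ℕ), StrictMono φ → ∃ ψ : ℕ → ℕ, StrictMono ψ ∧ ∃ d, Good m (φ ∘ ψ) d := by
    intro m φ hφ
    have hφm : ∀ k, m ≤ φ (k + m) := fun k => (Nat.le_add_left m k).trans (hφ.id_le (k + m))
    have hνt : Tendsto (fun k => ν (φ (k + m))) atTop (𝓝 0) :=
      hνlim.comp (hφ.tendsto_atTop.comp (tendsto_add_atTop_nat m))
    obtain ⟨σ', u, p, hσ', hsuit, hum, hu3, huE, hGu, hpm, hpb, hL3, hπw⟩ :=
      cylinder_compactness_vanishingViscosity (hcc_pos m) (ν := fun k => ν (φ (k + m)))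
        (fun k => hν0 _) (fun k => hν1 _) hνt (V := fun k => V (φ (k + m))) (P := fun k => P (φ (k + m)))
        (GV := fun k => GV (φ (k + m))) (C := C m) (hMp m) (fun k => hsw m _ (hφm k))
        (fun k => hG m _ (hφm k)) (fun k => hE m _ (hφm k)) (fun k => hGb m _ (hφm k))
        (fun k => hPb m _ (hφm k))
    refine ⟨fun k => σ' k + m, fun a b hab => Nat.add_lt_add_right (hσ' hab) m, (u, p), ?_⟩
    exact ⟨hsuit, hum, hu3, huE, hGu, hpm, hpb, hL3, hπw⟩
  -- ## the diagonal
  obtain ⟨σ, hσ, hgood⟩ := FunctionSpaces.exists_strictMono_forall_of_extraction hsub hex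
  choose d hd using hgood
  set ul : ℕ → ℝ → (EuclideanSpace ℝ (Fin 3)) → (EuclideanSpace ℝ (Fin 3)) := fun m => (d m).1 with hul
  set pl : ℕ → ℝ → (EuclideanSpace ℝ (Fin 3)) → ℝ := fun m => (d m).2 with hpl
  have hσm : ∀ m j, m ≤ σ (j + m) := fun m j => (Nat.le_add_left m j).trans (hσ.id_le (j + m))
  -- ## consecutive levels agree a.e. on the smaller cylinder
  have hpl_memLp : ∀ m, MemLp (uncurry (pl m)) (3 / 2) (μ m) := fun m =>
    (memLp_threeHalves_of_lintegral_le (hd m).2.2.2.2.2.1 (hMp m) (hd m).2.2.2.2.2.2.1).1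
  have hcons_u : ∀ m, ∀ᵐ z ∂(μ m), uncurry (ul m) z = uncurry (ul (m + 1)) z := by
    intro m
    have h1 := ((hd m).2.2.2.2.2.2.2.1).comp (tendsto_add_atTop_nat (m + 1))
    have h2' : Tendsto (fun j => eLpNorm (uncurry (V (σ j)) - uncurry (ul (m + 1))) 3 (μ m)) atTop
        (𝓝 0) :=
      tendsto_of_tendsto_of_tendsto_of_le_of_le tendsto_const_nhds (hd (m + 1)).2.2.2.2.2.2.2.1
        (fun _ => zero_le) fun j => eLpNorm_mono_measure _ (Measure.restrict_mono (hQs_mono m.le_succ) le_rfl)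
    have h2 := h2'.comp (tendsto_add_atTop_nat (m + 1))
    have hmeas : ∀ j, AEStronglyMeasurable (uncurry (V (σ (j + (m + 1))))) (μ m) := fun j =>
      ((hsw m _ ((Nat.le_succ m).trans (hσm (m + 1) j))).distributional.1.aestronglyMeasurable)
    exact ae_eq_of_tendsto_eLpNorm_sub (F := fun j => uncurry (V (σ (j + (m + 1))))) (by norm_num)
      hmeas (hd m).2.1 (((hd (m + 1)).2.1).mono_measure (Measure.restrict_mono (hQs_mono m.le_succ) le_rfl))
      h1 h2
  have hcons_p : ∀ m, ∀ᵐ z ∂(μ m), uncurry (pl m) z = uncurry (pl (m + 1)) z := by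
    intro m
    have hm2 : MemLp (uncurry (pl (m + 1))) (3 / 2) (μ m) :=
      (hpl_memLp (m + 1)).mono_measure (Measure.restrict_mono (hQs_mono m.le_succ) le_rfl)
    refine ae_eq_of_forall_setIntegral_mul_eq (hpl_memLp m) hm2 fun g hg => ?_
    have h1 := (hd m).2.2.2.2.2.2.2.2 g hg
    have h2 := SuitableCompactness.tendsto_setIntegral_mul_of_subset (hQsm m) (hQs_mono m.le_succ)
      (f := fun j z => P (σ j) z.1 z.2) (g := fun z => (pl (m + 1)) z.1 z.2) (hd (m + 1)).2.2.2.2.2.2.2.2 g hg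
    exact tendsto_nhds_unique h1 h2
  -- iterated consistency
  have hcons_u' : ∀ n m, n ≤ m → ∀ᵐ z ∂(μ n), uncurry (ul n) z = uncurry (ul m) z := by
    intro n m hnm
    induction m, hnm using Nat.le_induction with
    | base => exact ae_of_all _ fun z => rfl
    | succ m hnm ih =>
        filter_upwards [ih, ae_restrict_of_ae_restrict_of_subset (hQs_mono hnm) (hcons_u m)] with z h1 h2
        rw [h1, h2]
  have hcons_p' : ∀ n m, n ≤ m → ∀ᵐ z ∂(μ n), uncurry (pl n) z = uncurry (pl m) z := by
    intro n m hnm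
    induction m, hnm using Nat.le_induction with
    | base => exact ae_of_all _ fun z => rfl
    | succ m hnm ih =>
        filter_upwards [ih, ae_restrict_of_ae_restrict_of_subset (hQs_mono hnm) (hcons_p m)] with z h1 h2
        rw [h1, h2]
  -- ## gluing along the exhaustion `Q(0, 2ᵐ)`
  set N : ℝ × (EuclideanSpace ℝ (Fin 3)) → ℕ := fun z =>
    if h : ∃ m : ℕ, z ∈ Qs m then Nat.find h else 0 with hN
  have hNS : ∀ z ∈ ⋃ m : ℕ, Qs m, z ∈ Qs (N z) := by
    intro z hz
    have h : ∃ m : ℕ, z ∈ Qs m := mem_iUnion.1 hz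
    simp only [hN, dif_pos h]
    exact Nat.find_spec h
  have hNle : ∀ m, ∀ z ∈ Qs m, N z ≤ m := by
    intro m z hz
    have h : ∃ m : ℕ, z ∈ Qs m := ⟨m, hz⟩
    simp only [hN, dif_pos h]
    exact Nat.find_min' h hz
  obtain ⟨W, hW, -⟩ := FunctionSpaces.exists_glue_of_ae_eq
    (μ := (volume : Measure (ℝ × (EuclideanSpace ℝ (Fin 3))))) hQsm N hNS hNle (fun m => uncurry (ul m))
    hcons_u'
  obtain ⟨Pg, hPg, -⟩ := FunctionSpaces.exists_glue_of_ae_eq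
    (μ := (volume : Measure (ℝ × (EuclideanSpace ℝ (Fin 3))))) hQsm N hNS hNle (fun m => uncurry (pl m))
    hcons_p'
  set w : ℝ → (EuclideanSpace ℝ (Fin 3)) → (EuclideanSpace ℝ (Fin 3)) := fun s y => W (s, y) with hw
  set π : ℝ → (EuclideanSpace ℝ (Fin 3)) → ℝ := fun s y => Pg (s, y) with hπ
  have hw_m : ∀ m, ∀ᵐ z ∂(μ m), uncurry (ul m) z = uncurry w z := fun m => by
    filter_upwards [hW m] with z hz
    rw [← hz]
    rfl
  have hπ_m : ∀ m, ∀ᵐ z ∂(μ m), uncurry (pl m) z = uncurry π z := fun m => by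
    filter_upwards [hPg m] with z hz
    rw [← hz]
    rfl
  -- ## the level package for the glued pair
  have hlevel : ∀ m : ℕ,
      IsSuitableWeakSolutionOn (parabolicCylinderOpens (cc m) (0 : ℝ × (EuclideanSpace ℝ (Fin 3)))) 0 0 w π ∧
      MemLp (uncurry w) 3 (μ m) ∧
      (∀ᵐ t ∂(volume.restrict (Ioo (-(cc m) ^ 2) 0)),
        ∫⁻ x in ball (0 : (EuclideanSpace ℝ (Fin 3))) (cc m), ‖w t x‖ₑ ^ 2 ≤ C m) ∧
      (∃ Gu : ℝ → (EuclideanSpace ℝ (Fin 3)) → (EuclideanSpace ℝ (Fin 3)) →L[ℝ] (EuclideanSpace ℝ (Fin 3)),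
        HasWeakSpatialGradientOn (parabolicCylinderOpens (cc m) (0 : ℝ × (EuclideanSpace ℝ (Fin 3)))) w Gu ∧
        ∫⁻ z in Qs m, ENNReal.ofReal (frobeniusNormSq (Gu z.1 z.2)) ≤ C m) ∧
      AEStronglyMeasurable (uncurry π) (μ m) ∧
      ∫⁻ z in Qs m, ‖π z.1 z.2‖ₑ ^ (3 / 2 : ℝ) ≤ Mp m ∧
      Tendsto (fun j => eLpNorm (uncurry (V (σ j)) - uncurry w) 3 (μ m)) atTop (𝓝 0) ∧
      ∀ g : ℝ × (EuclideanSpace ℝ (Fin 3)) → ℝ, MemLp g 3 (μ m) →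
        Tendsto (fun j => ∫ z in Qs m, P (σ j) z.1 z.2 * g z) atTop (𝓝 (∫ z in Qs m, π z.1 z.2 * g z)) := by
    intro m
    obtain ⟨h1, h2, h3, h4, ⟨Gu, hGu, hGub⟩, h6, h7, h8, h9⟩ := hd m
    refine ⟨h1.congr_ae (hw_m m) (hπ_m m), h3.ae_eq (hw_m m), ?_, ⟨Gu, hGu.congr_ae (hw_m m), hGub⟩,
      h6.congr (hπ_m m), ?_, ?_, fun g hg => ?_⟩
    · -- the slice bound
      have e1 : ∀ᵐ z ∂((volume.restrict (Ioo (-(cc m) ^ 2) 0)).prod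
          (volume.restrict (ball (0 : (EuclideanSpace ℝ (Fin 3))) (cc m)))), uncurry (ul m) z = uncurry w z := by
        rw [Measure.prod_restrict, ← Measure.volume_eq_prod, ← SuitableCompactness.parabolicCylinder_zero]
        exact hw_m m
      have e2 := Measure.ae_ae_of_ae_prod e1
      filter_upwards [h4, e2] with t ht ht2
      calc ∫⁻ x in ball (0 : (EuclideanSpace ℝ (Fin 3))) (cc m), ‖w t x‖ₑ ^ 2
          = ∫⁻ x in ball (0 : (EuclideanSpace ℝ (Fin 3))) (cc m), ‖(ul m) t x‖ₑ ^ 2 := by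
            refine lintegral_congr_ae ?_
            filter_upwards [ht2] with x hx
            change (ul m) t x = w t x at hx
            rw [hx]
        _ ≤ C m := ht
    · -- the pressure bound
      calc ∫⁻ z in Qs m, ‖π z.1 z.2‖ₑ ^ (3 / 2 : ℝ) = ∫⁻ z in Qs m, ‖(pl m) z.1 z.2‖ₑ ^ (3 / 2 : ℝ) := by
            refine lintegral_congr_ae ?_
            filter_upwards [hπ_m m] with z hz
            change (pl m) z.1 z.2 = π z.1 z.2 at hz
            rw [hz]
        _ ≤ Mp m := h7
    · -- strong convergence
      refine (tendsto_congr fun j => ?_).1 h8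
      refine eLpNorm_congr_ae ?_
      filter_upwards [hw_m m] with z hz
      show uncurry (V (σ j)) z - uncurry (ul m) z = uncurry (V (σ j)) z - uncurry w z
      rw [hz]
    · -- weak convergence
      have e : ∫ z in Qs m, (pl m) z.1 z.2 * g z = ∫ z in Qs m, π z.1 z.2 * g z := by
        refine integral_congr_ae ?_
        filter_upwards [hπ_m m] with z hz
        change (pl m) z.1 z.2 = π z.1 z.2 at hz
        rw [hz]
      have h := h9 g hg
      rwa [e] at h
  -- ## suitability on the slab, by exhaustion
  set Qn : ℕ → Opens (ℝ × (EuclideanSpace ℝ (Fin 3))) :=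
    fun m => parabolicCylinderOpens (cc m) (0 : ℝ × (EuclideanSpace ℝ (Fin 3))) with hQn
  have hle : ∀ m, Qn m ≤ (slab (EuclideanSpace ℝ (Fin 3)) (Iio 0) isOpen_Iio) := fun m z hz =>
    parabolicCylinder_subset_lowerHalf le_rfl (cc m) hz
  have hmono : Monotone Qn := fun n m hnm z hz => hQs_mono hnm hz
  have hcov : ∀ K ⊆ ((slab (EuclideanSpace ℝ (Fin 3)) (Iio 0) isOpen_Iio :
      Opens (ℝ × (EuclideanSpace ℝ (Fin 3)))) : Set (ℝ × (EuclideanSpace ℝ (Fin 3)))),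
      IsCompact K → ∃ n, K ⊆ (Qn n : Set (ℝ × (EuclideanSpace ℝ (Fin 3)))) := by
    intro K hK hKc
    obtain ⟨n, hn⟩ := ESSBlowup.exists_subset_parabolicCylinder_of_isCompact hK hKc
    refine ⟨n + 1, hn.trans ?_⟩
    refine SuitableCompactness.parabolicCylinder_zero_mono (by positivity) ?_
    have h : ((n : ℝ) + 1) ≤ (2 : ℝ) ^ (n + 1) := by
      have h' : n + 1 ≤ 2 ^ (n + 1) := (Nat.lt_two_pow_self (n := n + 1)).le
      exact_mod_cast h'
    exact h
  have hslab : IsSuitableWeakSolutionOn (slab (EuclideanSpace ℝ (Fin 3)) (Iio 0) isOpen_Iio) 0 0 w π :=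
    IsSuitableWeakSolutionOn.of_exhaustion hle hmono hcov fun m => (hlevel m).1
  exact ⟨σ, w, π, hσ, hslab, hlevel⟩

end Summit.NavierStokesRegularity.NavierStokesRegularity.Theorems.SereginZoomReduction
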